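import Literature.NumberTheory.Transcendental.PeriodConjectureProofs
import Literature.NumberTheory.Transcendental.YoshinagaBoundedVolume
import Literature.NumberTheory.Transcendental.FiniteVolumeElementary
import HarnessLib

/-!
# A computable real number outside the ring of bounded semialgebraic volumes (Yoshinaga's corollary: the unconditional part, and its reduction to Lemma 24)

M. Yoshinaga, *Periods and elementary real numbers*, arXiv:0805.0349 (2008), deduces from his
main theorem (Thm. 18: real Kontsevich–Zagier periods are elementary real numbers) the corollary
"so the real number `α` constructed above is not a period" (§3.1), `α` being the computable
non-elementary real of Prop. 17 — the tree's named fact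
`Literature.NumberTheory.Transcendental.exists_isComputableReal_not_isRealPeriod`
(`PeriodConjecture.lean`, periods.S08). Thm. 18 itself is proved in two steps: Lemma 24 (the real
periods are generated by the volumes of bounded semialgebraic sets; Hironaka's rectilinearization
and the Belkale–Brosnan description of periods) and §3.3–3.6 (such volumes are elementary reals).

The tree proves the second step (`Yoshinaga.isElementaryReal_volume_of_isSemialgebraic_of_isBounded`,
`YoshinagaBoundedVolume.lean`), Prop. 17
(`Literature.Computability.Complexity.exists_isComputableReal_not_isElementaryReal`,
`NonElementaryReal.lean`) and the passage Thm. 18 ⇒ corollary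
(`exists_isComputableReal_not_isRealPeriod_of_isElementaryReal_of_isRealPeriod`,
`PeriodConjectureProofs.lean`); Lemma 24 (resolution of singularities) is the one input that is
not formalised. This file records what follows **without** Lemma 24, and the corollary from each of
the four forms in which the tree states Lemma 24 as a hypothesis, and from the resolution-free
tail-decay hypothesis of `FiniteVolumeElementary.lean`.

## Main statements

* `isElementaryReal_of_mem_addSubgroupClosure_boundedVolumes`,
  `isElementaryReal_of_mem_subringClosure_boundedVolumes` — every element of the additive subgroup
  (resp. subring) of `ℝ` generated by the volumes of bounded `ℚ`-semialgebraic sets is an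
  elementary real (Yoshinaga §3.3–3.6 with Prop. 10).
* `exists_isComputableReal_not_mem_addSubgroupClosure_boundedVolumes`,
  `exists_isComputableReal_not_mem_subringClosure_boundedVolumes` (unconditional) — there is a
  computable real number outside that subgroup (resp. subring): Yoshinaga's corollary for the class
  of numbers which Lemma 24 identifies with the real periods.
* `exists_isComputableReal_forall_value_ne_of_bounded`,
  `exists_isComputableReal_forall_integral_ne_of_bounded` (unconditional) — there is a computable
  real number which is not the value of any Kontsevich–Zagier integral with bounded domain and
  bounded integrand (the *proper* integrals `∫_σ p/q`; Lemma 24 (i) says every real period has such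
  a representation).
* `exists_isComputableReal_not_isRealPeriod_of_lemma24`, `…_of_lemma24'`,
  `…_of_boundedReduction`, `…_of_boundedRepresentation` — the named fact
  `exists_isComputableReal_not_isRealPeriod` from Lemma 24 in its additive / ring / "difference of
  two bounded volumes" (Viu-Sos 2021, Cor. 2.3) / "bounded representation" (Lemma 24 (i)) forms,
  by composing `isElementaryReal_of_isRealPeriod_of_lemma24` (etc., `YoshinagaBoundedVolume.lean`)
  with `exists_isComputableReal_not_isRealPeriod_of_isElementaryReal_of_isRealPeriod`.
* `exists_isComputableReal_not_isRealPeriod_of_tailDecay` — the named fact from the polynomial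
  tail-decay estimate `vol(E ∖ B(0, R)) ≤ C R^{−a}` for finite-volume `ℚ`-semialgebraic sets
  (Cluckers–Miller 2011, Thm. 1.3 with Prop. 1.5), the hypothesis `H` — verbatim — of
  `isElementaryReal_of_isRealPeriod_of_tailDecay` (`FiniteVolumeElementary.lean`) and of
  `isComputableReal_of_isRealPeriod_of_tailDecay` (`FiniteVolumeComputable.lean`), so that this one
  resolution-free input closes all four Yoshinaga facts (periods.S08) of `PeriodConjecture.lean`
  (`isComputableReal_of_isRealPeriod`, `isComputableComplex_of_isPeriod` by
  `FiniteVolumeComputable.lean`; `isElementaryReal_of_isRealPeriod` by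
  `FiniteVolumeElementary.lean`; `exists_isComputableReal_not_isRealPeriod` here).

In all seven existence statements the witness is the same real number, the computable
non-elementary real of `exists_isComputableReal_not_isElementaryReal`.

## References

* M. Yoshinaga, *Periods and elementary real numbers*, arXiv:0805.0349 (2008), §2.3 Prop. 17,
  §3.1 Thm. 18 and the sentence following it, §3.2 Lemma 24, §3.6.
* J. Viu-Sos, *A semi-canonical reduction for periods of Kontsevich–Zagier*, Int. J. Number
  Theory 17 (2021), Thm. 1.1, Cor. 2.3.
* K. Tent, M. Ziegler, *Computable functions of reals*, Münster J. Math. 3 (2010), Cor. 6.3, 6.4.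
* R. Cluckers, D. J. Miller, *Stability under integration of sums of products of real globally
  subanalytic functions and their logarithms*, Duke Math. J. 156 (2011), 311–348, Thm. 1.3,
  Prop. 1.5.

## Design notes

* Theorems only: no definition and no named fact is introduced (D-0026). The generating set of
  bounded volumes is written inline, literally as in `isElementaryReal_of_isRealPeriod_of_lemma24`,
  and "bounded representation" literally as in
  `isElementaryReal_of_isRealPeriod_of_boundedRepresentation`, so that the conditional theorems
  compose with those of `YoshinagaBoundedVolume.lean`, `BoundedPeriodComputable.lean` and
  `PeriodConjectureProofs.lean` without rewriting.
* What is NOT here: Lemma 24 in any form, and the tail-decay estimate. With either (Lemma 24,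
  Viu-Sos's semi-canonical reduction, or the Cluckers–Miller decay of `vol(E ∖ B(0, R))`) the last
  five theorems discharge the named fact in one line.
-/

noncomputable section

open _root_.MeasureTheory Set MvPolynomial
open Literature.Computability.Complexity Literature.ModelTheory.ExponentialFields

namespace Literature.NumberTheory.Transcendental

/-! ### The ring of bounded semialgebraic volumes consists of elementary reals -/

/-- **Sums and differences of volumes of bounded `ℚ`-semialgebraic sets are elementary reals.**
Every element of the additive subgroup of `ℝ` generated by
`{vol(D) | D ⊆ ℝ^m bounded ℚ-semialgebraic}` is an elementary real number: the generators are
elementary (`Yoshinaga.isElementaryReal_volume_of_isSemialgebraic_of_isBounded`, Yoshinaga 2008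
§3.3–3.6) and the elementary reals form an additive group (Prop. 10,
`IsElementaryReal.of_mem_addSubgroupClosure`). [cite: Yoshinaga2008, §3.6 with Prop. 10] -/
theorem isElementaryReal_of_mem_addSubgroupClosure_boundedVolumes {x : ℝ}
    (hx : x ∈ AddSubgroup.closure {v : ℝ | ∃ (m : ℕ) (D : Set (Fin m → ℝ)),
      IsSemialgebraic ℚ D ∧ Bornology.IsBounded D ∧ v = (volume D).toReal}) :
    IsElementaryReal x := by
  refine IsElementaryReal.of_mem_addSubgroupClosure ?_ hx
  rintro v ⟨m, D, hD, hb, rfl⟩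
  exact Yoshinaga.isElementaryReal_volume_of_isSemialgebraic_of_isBounded hD hb

/-- **The subring generated by the volumes of bounded `ℚ`-semialgebraic sets consists of
elementary reals** (ring form of the previous theorem: the elementary reals form a ring, Prop. 10,
`IsElementaryReal.of_mem_subringClosure`). [cite: Yoshinaga2008, §3.6 with Prop. 10] -/
theorem isElementaryReal_of_mem_subringClosure_boundedVolumes {x : ℝ}
    (hx : x ∈ Subring.closure {v : ℝ | ∃ (m : ℕ) (D : Set (Fin m → ℝ)),
      IsSemialgebraic ℚ D ∧ Bornology.IsBounded D ∧ v = (volume D).toReal}) :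
    IsElementaryReal x := by
  refine IsElementaryReal.of_mem_subringClosure ?_ hx
  rintro v ⟨m, D, hD, hb, rfl⟩
  exact Yoshinaga.isElementaryReal_volume_of_isSemialgebraic_of_isBounded hD hb

/-! ### Unconditional: a computable real outside the ring of bounded volumes -/

/-- **A computable real number which is not a sum of ± volumes of bounded `ℚ`-semialgebraic
sets** (unconditional). The computable non-elementary real of Yoshinaga 2008, Prop. 17
(`exists_isComputableReal_not_isElementaryReal`) lies outside the additive subgroup of `ℝ`
generated by the volumes of bounded `ℚ`-semialgebraic sets, all of whose elements are elementary
(`isElementaryReal_of_mem_addSubgroupClosure_boundedVolumes`). By Lemma 24 of loc. cit. this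
subgroup is the group of real periods; that identification (resolution of singularities) is not
used here. [cite: Yoshinaga2008, §3.1 sentence after Thm. 18, with Prop. 17 and §3.6] -/
theorem exists_isComputableReal_not_mem_addSubgroupClosure_boundedVolumes :
    ∃ x : ℝ, IsComputableReal x ∧
      x ∉ AddSubgroup.closure {v : ℝ | ∃ (m : ℕ) (D : Set (Fin m → ℝ)),
        IsSemialgebraic ℚ D ∧ Bornology.IsBounded D ∧ v = (volume D).toReal} := by
  obtain ⟨x, hx, hne⟩ := exists_isComputableReal_not_isElementaryReal
  exact ⟨x, hx, fun h => hne (isElementaryReal_of_mem_addSubgroupClosure_boundedVolumes h)⟩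

/-- **A computable real number outside the subring generated by the volumes of bounded
`ℚ`-semialgebraic sets** (unconditional; ring form of the previous theorem).
[cite: Yoshinaga2008, §3.1 sentence after Thm. 18, with Prop. 17 and §3.6] -/
theorem exists_isComputableReal_not_mem_subringClosure_boundedVolumes :
    ∃ x : ℝ, IsComputableReal x ∧
      x ∉ Subring.closure {v : ℝ | ∃ (m : ℕ) (D : Set (Fin m → ℝ)),
        IsSemialgebraic ℚ D ∧ Bornology.IsBounded D ∧ v = (volume D).toReal} := by
  obtain ⟨x, hx, hne⟩ := exists_isComputableReal_not_isElementaryReal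
  exact ⟨x, hx, fun h => hne (isElementaryReal_of_mem_subringClosure_boundedVolumes h)⟩

/-! ### Unconditional: a computable real which is not a period with bounded data -/

/-- **A computable real number which is not the value of any Kontsevich–Zagier integral
representation with bounded domain and bounded integrand** (unconditional). Such values are
elementary reals (`KZ.IntegralRep.isElementaryReal_value_of_bounded`: the value is
`vol(E₊) - vol(E₋)` for the bounded `ℚ`-semialgebraic strict subgraphs, Yoshinaga 2008, proof of
Lemma 24 (i), followed by §3.3–3.6), and the computable real of Prop. 17 is not elementary.
Lemma 24 (i) asserts that every real period has such a representation; that is not used here.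
[cite: Yoshinaga2008, §3.1 sentence after Thm. 18, with Prop. 17 and Lemma 24 (i)] -/
theorem exists_isComputableReal_forall_value_ne_of_bounded :
    ∃ x : ℝ, IsComputableReal x ∧
      ∀ (n : ℕ) (r : KZ.IntegralRep n), Bornology.IsBounded r.domain →
        (∃ M : ℝ, ∀ y ∈ r.domain, |r.integrand y| ≤ M) → r.value ≠ x := by
  obtain ⟨x, hx, hne⟩ := exists_isComputableReal_not_isElementaryReal
  refine ⟨x, hx, fun n r hb hM h => hne ?_⟩
  rw [← h]
  exact r.isElementaryReal_value_of_bounded hb hM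

/-- **A computable real number which is not a proper Kontsevich–Zagier integral** (unconditional,
KZ-literal form of the previous theorem): there is a computable real `x` such that
`x ≠ ∫_σ p/q` whenever `σ ⊆ ℝⁿ` is a *bounded* `ℚ`-semialgebraic set and `p, q ∈ ℚ[x₁, …, xₙ]`
with `q ≠ 0` on `σ`, `p/q` absolutely integrable and *bounded* on `σ`. (Through
`KZ.IntegralRep.ofRational`.)
[cite: Yoshinaga2008, §3.1 sentence after Thm. 18, with Prop. 17 and Lemma 24 (i)] -/
theorem exists_isComputableReal_forall_integral_ne_of_bounded :
    ∃ x : ℝ, IsComputableReal x ∧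
      ∀ (n : ℕ) (σ : Set (Fin n → ℝ)) (p q : MvPolynomial (Fin n) ℚ)
        (hσ : IsSemialgebraic ℚ σ) (hq : ∀ y ∈ σ, aeval y q ≠ 0)
        (_hint : IntegrableOn (fun y => aeval y p / aeval y q) σ),
        Bornology.IsBounded σ → (∃ M : ℝ, ∀ y ∈ σ, |aeval y p / aeval y q| ≤ M) →
          ∫ y in σ, aeval y p / aeval y q ≠ x := by
  obtain ⟨x, hx, hne⟩ := exists_isComputableReal_forall_value_ne_of_bounded
  refine ⟨x, hx, fun n σ p q hσ hq hint hb hM => ?_⟩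
  have h := hne n (KZ.IntegralRep.ofRational σ p q hσ hq hint) hb hM
  rwa [KZ.IntegralRep.value_ofRational] at h

/-! ### The named fact from each form of Lemma 24 -/

/-- **Yoshinaga's corollary from his Lemma 24** (additive reading of "generated"). If every real
period lies in the additive subgroup of `ℝ` generated by the volumes of bounded `ℚ`-semialgebraic
sets (Yoshinaga 2008, Lemma 24), then there is a computable real number which is not a real
period: Lemma 24 gives Thm. 18 (`isElementaryReal_of_isRealPeriod_of_lemma24`) and Thm. 18 gives
the corollary (`exists_isComputableReal_not_isRealPeriod_of_isElementaryReal_of_isRealPeriod`).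
[cite: Yoshinaga2008, §3.1 sentence after Thm. 18, with Lemma 24] -/
theorem exists_isComputableReal_not_isRealPeriod_of_lemma24
    (h : ∀ x : ℝ, IsRealPeriod x →
      x ∈ AddSubgroup.closure {v : ℝ | ∃ (m : ℕ) (D : Set (Fin m → ℝ)),
        IsSemialgebraic ℚ D ∧ Bornology.IsBounded D ∧ v = (volume D).toReal}) :
    exists_isComputableReal_not_isRealPeriod :=
  exists_isComputableReal_not_isRealPeriod_of_isElementaryReal_of_isRealPeriod
    (isElementaryReal_of_isRealPeriod_of_lemma24 h)

/-- **Yoshinaga's corollary from his Lemma 24, ring form** ("generated" read as ring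
generation; through `isElementaryReal_of_isRealPeriod_of_lemma24'`).
[cite: Yoshinaga2008, §3.1 sentence after Thm. 18, with Lemma 24] -/
theorem exists_isComputableReal_not_isRealPeriod_of_lemma24'
    (h : ∀ x : ℝ, IsRealPeriod x →
      x ∈ Subring.closure {v : ℝ | ∃ (m : ℕ) (D : Set (Fin m → ℝ)),
        IsSemialgebraic ℚ D ∧ Bornology.IsBounded D ∧ v = (volume D).toReal}) :
    exists_isComputableReal_not_isRealPeriod :=
  exists_isComputableReal_not_isRealPeriod_of_isElementaryReal_of_isRealPeriod
    (isElementaryReal_of_isRealPeriod_of_lemma24' h)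

/-- **Yoshinaga's corollary from the bounded reduction of periods** (every real period is
`vol(K₁) - vol(K₂)` with `K₁, K₂` bounded `ℚ`-semialgebraic: Viu-Sos 2021, Cor. 2.3 / Yoshinaga
2008, Lemma 24, taken as a hypothesis as in
`isElementaryReal_of_isRealPeriod_of_boundedReduction`).
[cite: Yoshinaga2008, §3.1 sentence after Thm. 18, with Lemma 24] -/
theorem exists_isComputableReal_not_isRealPeriod_of_boundedReduction
    (H : ∀ x : ℝ, IsRealPeriod x → ∃ (d : ℕ) (K₁ K₂ : Set (Fin d → ℝ)),
      IsSemialgebraic ℚ K₁ ∧ IsSemialgebraic ℚ K₂ ∧ Bornology.IsBounded K₁ ∧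
        Bornology.IsBounded K₂ ∧ x = (volume K₁).toReal - (volume K₂).toReal) :
    exists_isComputableReal_not_isRealPeriod :=
  exists_isComputableReal_not_isRealPeriod_of_isElementaryReal_of_isRealPeriod
    (isElementaryReal_of_isRealPeriod_of_boundedReduction H)

/-- **Yoshinaga's corollary from bounded representations** (every real period is the value of an
integral representation with bounded domain and bounded integrand: Yoshinaga 2008, Lemma 24 (i),
taken as a hypothesis as in `isElementaryReal_of_isRealPeriod_of_boundedRepresentation`).
[cite: Yoshinaga2008, §3.1 sentence after Thm. 18, with Lemma 24 (i)] -/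
theorem exists_isComputableReal_not_isRealPeriod_of_boundedRepresentation
    (H : ∀ x : ℝ, IsRealPeriod x → ∃ (n : ℕ) (r : KZ.IntegralRep n),
      Bornology.IsBounded r.domain ∧ (∃ M : ℝ, ∀ y ∈ r.domain, |r.integrand y| ≤ M) ∧
        r.value = x) :
    exists_isComputableReal_not_isRealPeriod :=
  exists_isComputableReal_not_isRealPeriod_of_isElementaryReal_of_isRealPeriod
    (isElementaryReal_of_isRealPeriod_of_boundedRepresentation H)

/-! ### The named fact from polynomial tail decay (resolution-free form of the missing input) -/

/-- **Yoshinaga's corollary from polynomial tail decay.** If every `ℚ`-semialgebraic set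
`E ⊆ ℝ^m` of finite volume satisfies `vol(E ∖ B(0, R)) ≤ C R^{-a}` for `R ≥ 1`, for some `C` and
some `a > 0` (sup-norm balls) — the decay theorem of tame integration theory [Cluckers–Miller
2011, Thm. 1.3 (the function `R ↦ vol(E ∖ B(0, R))` is constructible) with Prop. 1.5 (decay rates
of constructible functions tending to `0`)], taken here as the explicit hypothesis `H`, verbatim
that of `isElementaryReal_of_isRealPeriod_of_tailDecay` (`FiniteVolumeElementary.lean`) and of
`isComputableReal_of_isRealPeriod_of_tailDecay` (`FiniteVolumeComputable.lean`), and NOT asserted —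
then there is a computable real number which is not a real period: tail decay gives Thm. 18 by
exhausting the two strict subgraphs of a period by boxes at an elementary rate
(`isElementaryReal_of_isRealPeriod_of_tailDecay`), and Thm. 18 gives the corollary
(`exists_isComputableReal_not_isRealPeriod_of_isElementaryReal_of_isRealPeriod`, the diagonal real
of Prop. 17). This is the resolution-free route to the sentence "So the real number `α`
constructed above is not a period" of Yoshinaga 2008, §3.1.
[cite: Yoshinaga2008, §3.1 sentence after Thm. 18, with Prop. 17] -/
theorem exists_isComputableReal_not_isRealPeriod_of_tailDecay
    (H : ∀ (m : ℕ) (E : Set (Fin m → ℝ)), IsSemialgebraic ℚ E → volume E ≠ ⊤ →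
      ∃ C a : ℝ, 0 < a ∧ ∀ R : ℝ, 1 ≤ R →
        volume (E \ Metric.ball 0 R) ≤ ENNReal.ofReal (C * R ^ (-a))) :
    exists_isComputableReal_not_isRealPeriod :=
  exists_isComputableReal_not_isRealPeriod_of_isElementaryReal_of_isRealPeriod
    (isElementaryReal_of_isRealPeriod_of_tailDecay H)

end Literature.NumberTheory.Transcendental
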